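import Summits.BirchSwinnertonDyer.Rank1Residual.X11b.KolyvaginHeegnerTower
import Summits.BirchSwinnertonDyer.Rank1Residual.X11b.KolyvaginRingClassCardinality
import Summits.BirchSwinnertonDyer.Rank1Residual.X11b.RingClassFieldConj
import Literature.NumberTheory.NumberFields.ArtinMapDecompositionInertia
import Literature.NumberTheory.EllipticCurves.RingClassFieldSplitting
import HarnessLib

/-!
# T1 JET (cell `bsd-jet`), road K, gap `htr` — BRICK B1 (Galois): at a Kolyvagin prime `ℓ ∣ c`, a
# decomposition element of `Γ_K` above `λ = (ℓ)` fixing `K[ℓ]` fixes all of `K[c]`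
# («`K[ℓ]_{λ'} = K[c]_{λ''}`», Howard 2004, proof of Lemma 2.7.3)

HONEST FRAMING (programme file §HONESTY, verbatim): «no tranche here proves BSD; ARM L moves the
LITERAL column of an r ≤ 1 census into the kernel-proved-modulo-named-print column.» THEOREMS ONLY
(seat `bsd-jet-pv-2`, session g5; `--supports stmt-BirchSwinnertonDyer-14418`, helper); 0 classes
move. WHAT THIS IS. The completion-layer gap `htr` of the road-K END FORMS («`c_k(c) ∈ transverseKer ℓ`
for `ℓ ∣ c`», Howard 2004 Lemma 2.7.3) needs, at a place `w'` of `K[ℓ]` over `λ = (ℓ)`, that the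
image of `Γ_{K[ℓ]_{w'}}` in `Γ_K` fixes the derived Heegner point `P(c) ∈ E(K[c])`: printed as
*"`λ'` splits completely in `K[n]`, so `K[ℓ]_{λ'} = K[n]_{λ''}`"*. This file proves the Galois-group
form of that sentence for the tree's concrete ring class fields `K[m] = ringClassField K ι m ⊂ ℂ`
(`K` imaginary quadratic with `d_K < -4`, `c` square-free with inert prime factors, `ℓ ∣ c`):
* `smul_algHom_eq_self_of_mem_splitPrimes_of_mem_decompositionSubgroup` — a decomposition element
  of `Γ_K` at a prime above a completely split `v` fixes every `K`-embedded copy of the field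
  (Neukirch I (9.3); the tree's `absRestrictNormalHom_eq_one_of_mem_splitPrimes_of_mem_stabilizer`);
* **`smul_ringClassField_emb_eq_of_mem_decompositionSubgroup`** — for `𝔓 ∣ λ` and
  `g ∈ D_𝔓 ≤ Γ_K`, if `g` fixes `e(x)` for the `x ∈ K[c]` lying in `K[ℓ]`, then `g` fixes `e(K[c])`
  pointwise. Proof: `g` restricts to `g_c ∈ 𝒢_c = Gal(K[c]/K)` (`K[c]/ℚ` Galois, x11b3
  `RingClassConj.exists_algEquiv_forall_apply_eq`); `λ` splits completely in `K[c/ℓ]` (Cox Thm. 9.2,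
  tree `mem_splitPrimes_ringClassField_of_span_natCast`), so `g_c ∈ G_ℓ = Gal(K[c]/K[c] ∩ K[c/ℓ])`,
  cyclic of order `ℓ + 1` generated by `σ_ℓ` (x11b3 `exists_coherent_towerData`); `g_c` also fixes
  `K[c] ∩ K[ℓ]`, so its restriction to `K[ℓ]` is trivial (`restrictHom_eq_one_of_mem`), while `σ_ℓ`
  restricts to a generator of `Gal(K[ℓ]/K[1])`, of order `ℓ + 1` as well
  (`card_ringClassGalOver_div_eq_succ`, where `d_K < -4` enters: for `d_K ∈ {-3, -4}` the order is
  `(ℓ+1)/3`, `(ℓ+1)/2` and the statement FAILS — `K[ℓℓ'] ⊋ K[ℓ]K[ℓ']`); hence `g_c = σ_ℓ^j` with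
  `ℓ + 1 ∣ j`, i.e. `g_c = 1`.
References: [cite: Howard2004HeegnerKolyvagin, Lemma 2.7.3 (proof)] [cite: GrossLMS1991, §3
(p. 217 l. 1–3, p. 218 l. 1)] [cite: Cox2013, §9.A Thm. 9.2, Lemma 9.3] [cite: NeukirchANT1999,
Ch. I §9 Prop. (9.3)].
-/

set_option autoImplicit false

noncomputable section

open scoped Classical Pointwise

open Field NumberField IsDedekindDomain Module
  Literature.NumberTheory.EllipticCurves Literature.NumberTheory.EllipticCurves.RingClassField
  Literature.NumberTheory.GaloisRepresentations Literature.NumberTheory.NumberFields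
  Summit.BirchSwinnertonDyer.Rank1Residual.X11b

namespace Summit.BirchSwinnertonDyer.Rank1Residual.JET

variable {K : Type} [Field K] [NumberField K]

/-! ## §1 Decomposition elements above a completely split prime fix the embedded field -/

/-- **A decomposition element above a completely split prime fixes every embedded copy of the
field.** For `E/K` finite Galois, `e : E → K̄` over `K`, `v` splitting completely in `E`, a prime
`𝔓 ∣ v` of `\bar ℤ_K` and `g ∈ D_𝔓 ≤ Γ_K`: `g • e x = e x` (the decomposition group of `𝔓 ∩ 𝓞_E`
in `Gal(E/K)` is trivial, Neukirch I (9.3); tree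
`absRestrictNormalHom_eq_one_of_mem_splitPrimes_of_mem_stabilizer`, applied to the image `e(E)`).
[cite: NeukirchANT1999, Ch. I §9 Prop. (9.3)] -/
theorem smul_algHom_eq_self_of_mem_splitPrimes_of_mem_decompositionSubgroup {E : Type} [Field E]
    [NumberField E] [Algebra K E] [IsGalois K E] (e : E →ₐ[K] AlgebraicClosure K)
    {v : HeightOneSpectrum (𝓞 K)} (hv : v ∈ splitPrimes K E) {𝔓 : Ideal (absIntegers (𝓞 K) K)}
    (h𝔓 : 𝔓 ∈ v.primesAbove) {g : absoluteGaloisGroup K}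
    (hg : g ∈ 𝔓.decompositionSubgroup (absoluteGaloisGroup K)) (x : E) :
    g • e x = e x := by
  set ε : E ≃ₐ[K] e.fieldRange :=
    (show E ≃ₐ[K] e.fieldRange from AlgEquiv.ofInjectiveField e) with hεdef
  haveI : FiniteDimensional K e.fieldRange := LinearEquiv.finiteDimensional ε.toLinearEquiv
  haveI : IsGalois K e.fieldRange := IsGalois.of_algEquiv ε
  haveI : NumberField e.fieldRange := NumberField.of_module_finite K e.fieldRange
  have hv' : v ∈ splitPrimes K e.fieldRange := by
    rw [← splitPrimes_congr ε]
    exact hv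
  have h1 := absRestrictNormalHom_eq_one_of_mem_splitPrimes_of_mem_stabilizer e.fieldRange hv' h𝔓 hg
  have hx : e x ∈ e.fieldRange := ⟨x, rfl⟩
  have h2 := AlgEquiv.restrictNormalHom_apply e.fieldRange (absoluteGaloisGroup.toAlgEquiv K g)
    ⟨e x, hx⟩
  change ((absRestrictNormalHom e.fieldRange g ⟨e x, hx⟩ : e.fieldRange) : AlgebraicClosure K) = _
    at h2
  rw [h1, AlgEquiv.one_apply] at h2
  rw [absoluteGaloisGroup.smul_def]
  exact h2.symm

/-! ## §2 The ring class field: `D_𝔓 ∩ Fix(K[ℓ])` fixes `K[c]` -/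

/-- An element of `Γ_K` restricts along a `K`-embedding `e : K[n] → K̄` to an element of
`𝒢_n = Gal(K[n]/K)`: `g • e x = e (g_n x)` with `g_n` fixing `ι(K)` (`K[n]/ℚ` is Galois, x11b3
`RingClassConj.exists_algEquiv_forall_apply_eq`). [cite: Cox2013, §9.A Lemma 9.3] -/
theorem exists_mem_ringClassGal_smul_emb_eq (hK : IsImaginaryQuadratic K) (ι : K →+* ℂ) {n : ℕ}
    (hn : n ≠ 0) (e : ringClassField K ι n →ₐ[K] AlgebraicClosure K) (g : absoluteGaloisGroup K) :
    ∃ gn ∈ ringClassGal ι n, ∀ x, g • e x = e (gn x) := by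
  obtain ⟨gn, hgn⟩ := RingClassConj.exists_algEquiv_forall_apply_eq hK ι hn
    (e : ringClassField K ι n →+* AlgebraicClosure K)
    (((absoluteGaloisGroup.toAlgEquiv K g : AlgebraicClosure K ≃ₐ[K] AlgebraicClosure K) :
      AlgebraicClosure K →+* AlgebraicClosure K).comp (e : ringClassField K ι n →+* AlgebraicClosure K))
  have hgn' : ∀ x, g • e x = e (gn x) := fun x ↦ by
    rw [absoluteGaloisGroup.smul_def]
    exact hgn x
  refine ⟨gn, ?_, hgn'⟩
  refine (_root_.mem_fixingSubgroup_iff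
    (M := ringClassField K ι n ≃ₐ[ℚ] ringClassField K ι n)).mpr ?_
  rintro y ⟨k, hk⟩
  have hy : y = algebraMap K (ringClassField K ι n) k :=
    Subtype.ext (by rw [coe_algebraMap_ringClassField, hk])
  apply e.injective
  change e (gn y) = e y
  rw [← hgn', hy, AlgHom.commutes, absoluteGaloisGroup.smul_def, AlgEquiv.commutes]

/-- If `g • e x = e (gn x)` and `g` fixes `e x` for the `x ∈ K[n]` lying in `K[d]`, then
`gn ∈ Gal(K[n]/K[n] ∩ K[d])`. [folklore] -/
theorem mem_ringClassGalOver_of_smul_emb_eq {ι : K →+* ℂ} {n d : ℕ}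
    (e : ringClassField K ι n →ₐ[K] AlgebraicClosure K) {g : absoluteGaloisGroup K}
    {gn : ringClassField K ι n ≃ₐ[ℚ] ringClassField K ι n} (hgn : ∀ x, g • e x = e (gn x))
    (hfix : ∀ x : ringClassField K ι n, (x : ℂ) ∈ ringClassField K ι d → g • e x = e x) :
    gn ∈ ringClassGalOver ι n d := by
  refine (_root_.mem_fixingSubgroup_iff
    (M := ringClassField K ι n ≃ₐ[ℚ] ringClassField K ι n)).mpr fun y hy ↦ ?_
  apply e.injective
  change e (gn y) = e y
  rw [← hgn]
  exact hfix y hy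

/-- **`D_𝔓 ∩ Fix(K[ℓ])` fixes `K[c]`** («`K[ℓ]_{λ'} = K[c]_{λ''}`», Howard 2004, proof of
Lemma 2.7.3). For `K` imaginary quadratic with `d_K < -4`, `c` square-free with all prime factors
inert in `K`, a prime `ℓ ∣ c`, the place `λ = (ℓ)` of `K`, a prime `𝔓 ∣ λ` of `\bar ℤ_K`, a
`K`-embedding `e : K[c] → K̄` and `g ∈ D_𝔓 ≤ Γ_K` with `g • e x = e x` whenever `x ∈ K[ℓ]`: then
`g • e x = e x` for every `x ∈ K[c]`. See the module docstring for the proof (complete splitting of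
`λ` in `K[c/ℓ]`, `G_ℓ` cyclic of order `ℓ + 1` at levels `c` and `ℓ`). The hypothesis `d_K < -4`
is necessary. [cite: Howard2004HeegnerKolyvagin, Lemma 2.7.3 (proof)]
[cite: GrossLMS1991, §3 (p. 217 l. 1–3)] [cite: Cox2013, §9.A Thm. 9.2] -/
theorem smul_ringClassField_emb_eq_of_mem_decompositionSubgroup (hK : IsImaginaryQuadratic K)
    (hD : NumberField.discr K < -4) (ι : K →+* ℂ) [∀ j : ℕ, NumberField (ringClassField K ι j)]
    {c ℓ : ℕ} (hc : Squarefree c) (hℓ : ℓ.Prime) (hℓc : ℓ ∣ c)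
    (hinert : ∀ q ∈ c.primeFactors, (Ideal.span {(q : 𝓞 K)}).IsPrime)
    {v : HeightOneSpectrum (𝓞 K)} (hv : v.asIdeal = Ideal.span {((ℓ : ℕ) : 𝓞 K)})
    {𝔓 : Ideal (absIntegers (𝓞 K) K)} (h𝔓 : 𝔓 ∈ v.primesAbove)
    (e : ringClassField K ι c →ₐ[K] AlgebraicClosure K) {g : absoluteGaloisGroup K}
    (hg : g ∈ 𝔓.decompositionSubgroup (absoluteGaloisGroup K))
    (hfix : ∀ x : ringClassField K ι c, (x : ℂ) ∈ ringClassField K ι ℓ → g • e x = e x)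
    (x : ringClassField K ι c) : g • e x = e x := by
  have hc0 : c ≠ 0 := hc.ne_zero
  have hℓ0 : ℓ ≠ 0 := hℓ.ne_zero
  have hcℓ0 : c / ℓ ≠ 0 := (Nat.div_pos (Nat.le_of_dvd (Nat.pos_of_ne_zero hc0) hℓc) hℓ.pos).ne'
  have hℓcℓ : ¬ ℓ ∣ c / ℓ := fun h ↦ by
    have : ℓ * ℓ ∣ c := by
      have := Nat.mul_dvd_mul_left ℓ h
      rwa [Nat.mul_div_cancel' hℓc] at this
    exact hℓ.not_isUnit (hc ℓ this)
  have hℓpf : ℓ ∈ c.primeFactors := Nat.mem_primeFactors.mpr ⟨hℓ, hℓc, hc0⟩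
  have hinertℓ : (Ideal.span {(ℓ : 𝓞 K)}).IsPrime := hinert ℓ hℓpf
  haveI := (finiteDimensional_and_isGalois_ringClassField hK ι hcℓ0).1
  haveI := (finiteDimensional_and_isGalois_ringClassField hK ι hcℓ0).2
  -- `g` restricts to `gc ∈ 𝒢_c`
  obtain ⟨gc, hgcG, hgc⟩ := exists_mem_ringClassGal_smul_emb_eq hK ι hc0 e g
  -- `gc ∈ Gal(K[c]/K[c] ∩ K[ℓ])`
  have hgcB : gc ∈ ringClassGalOver ι c ℓ := mem_ringClassGalOver_of_smul_emb_eq e hgc hfix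
  -- `λ` splits completely in `K[c/ℓ]`, so `g` fixes `e(K[c] ∩ K[c/ℓ])`: `gc ∈ G_ℓ`
  have hle : ringClassField K ι (c / ℓ) ≤ ringClassField K ι c :=
    ringClassField_mono hK ι (Nat.div_dvd_of_dvd hℓc) hc0
  have hsplit : v ∈ splitPrimes K (ringClassField K ι (c / ℓ)) :=
    mem_splitPrimes_ringClassField_of_span_natCast hK ι hcℓ0 hv
      ((Nat.Prime.coprime_iff_not_dvd hℓ).mpr hℓcℓ)
  have hgcA : gc ∈ ringClassGalOver ι c (c / ℓ) := by
    refine mem_ringClassGalOver_of_smul_emb_eq e hgc fun y hy ↦ ?_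
    let y' : ringClassField K ι (c / ℓ) := ⟨(y : ℂ), hy⟩
    have hyy' : y = RingClassField.inclusion ι hle y' :=
      Subtype.ext (by rw [RingClassField.coe_inclusion])
    rw [hyy']
    exact smul_algHom_eq_self_of_mem_splitPrimes_of_mem_decompositionSubgroup
      (e.comp (RingClassField.inclusion ι hle)) hsplit h𝔓 hg y'
  -- the coherent tower over `c`: restriction maps and the generator `σ_ℓ`
  obtain ⟨res, gen, T, hval, hid, -, hgen, -⟩ :=
    RingClassTower.exists_coherent_towerData hK ι hc hinert
  -- at level `c`: `G_ℓ = ⟨σ⟩` with `σ^{ℓ+1} = 1`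
  obtain ⟨hzc, hpowc⟩ := hgen c dvd_rfl ℓ hℓpf
  rw [hid] at hzc hpowc
  -- at level `ℓ`: `res_ℓ σ` generates `Gal(K[ℓ]/K[1])`, of order `ℓ + 1`
  have hℓpfℓ : ℓ ∈ ℓ.primeFactors := Nat.mem_primeFactors.mpr ⟨hℓ, dvd_rfl, hℓ0⟩
  obtain ⟨hzℓ, -⟩ := hgen ℓ hℓc ℓ hℓpfℓ
  have hcard : Nat.card (ringClassGalOver ι ℓ (ℓ / ℓ)) = ℓ + 1 :=
    RingClassTower.card_ringClassGalOver_div_eq_succ hK ι hℓ hinertℓ dvd_rfl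
      (by rw [Nat.div_self hℓ.pos]; exact hℓ.one_lt.ne' ∘ Nat.dvd_one.mp) hℓ0 (Or.inr hD)
  have hord : orderOf (res ℓ (gen ℓ)) = ℓ + 1 := by
    rw [← Nat.card_zpowers, hzℓ, hcard]
  -- `gc = σ^j`
  obtain ⟨j, hj⟩ := Subgroup.mem_zpowers_iff.mp (hzc ▸ hgcA :
    gc ∈ Subgroup.zpowers ((gen ℓ : ringClassGal ι c) : ringClassField K ι c ≃ₐ[ℚ] ringClassField K ι c))
  let gc' : ringClassGal ι c := ⟨gc, hgcG⟩
  have hgc' : gc' = gen ℓ ^ j := Subtype.ext (show gc = _ by rw [Subgroup.coe_zpow, hj])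
  -- `res_ℓ gc = 1` since `gc` fixes `K[c] ∩ K[ℓ]`
  have hres1 : res ℓ gc' = 1 :=
    RingClassTower.restrictHom_eq_one_of_mem hK ι hℓc hc0 (hval ℓ hℓc) gc' hgcB
  rw [hgc', map_zpow] at hres1
  -- so `ℓ + 1 ∣ j` and `gc = σ^j = 1`
  have hdvd : ((ℓ + 1 : ℕ) : ℤ) ∣ j := by
    rw [← hord]
    exact orderOf_dvd_iff_zpow_eq_one.mpr hres1
  have hgen1 : (gen ℓ : ringClassGal ι c) ^ ((ℓ + 1 : ℕ) : ℤ) = 1 := by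
    rw [zpow_natCast]
    exact Subtype.ext (by rw [Subgroup.coe_pow, Subgroup.coe_one]; exact hpowc)
  have hgc1 : gc = 1 := by
    obtain ⟨q, hq⟩ := hdvd
    have : gc' = 1 := by rw [hgc', hq, zpow_mul, hgen1, one_zpow]
    exact congrArg Subtype.val this
  rw [hgc, hgc1, AlgEquiv.one_apply]

end Summit.BirchSwinnertonDyer.Rank1Residual.JET

end
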